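import Summits.CriticalPhenomena.PercolationContinuityZ3.Theorems.PercNearOneGluingNoHeavyLowerTailSahiSubsetChordReduction
import Mathlib.Tactic.Linarith
import Mathlib.Tactic.Ring
import HarnessLib

/-!
# `NoHeavyLowerTail` (stmt-CriticalPhenomena-4575) — the CO-SINGLETON bound `E₃ ≥ q_j(1−q_j)·J_j` and the COIN-vs-REST alternative

Support file, seat `prim-l12-p5` (gen 2), `--supports stmt-CriticalPhenomena-4575`.  STATEMENT-FIRST for the lane's sharpened
conjecture, plus two PROVED facts about it.

Setting (as in `…SahiSubsetChord`): finite index type `ι`, product weight `w_q` on `ι → Bool`, a triple `f` of monotone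
`{0,1}`-valued functions.  For a coordinate `j` write `S = univ.erase j` (all OTHER coordinates) and, for `v ∈ {0,1}^S`,
`lo j v`, `hi j v` for the two configurations extending `v` by `x_j = 0`, `x_j = 1`.  The SECTION of `f_a` at `v` is the one-coin
function `x_j ↦ f_a(v, x_j)`; it is pivotal iff `π_a(v) := f_a(hi) − f_a(lo) = 1`.

* `CoSingletonBound` (CoS, `@[conjecture]`, an obligation OF THIS PROGRAMME, not a published fact): for every such data with
  `|ι| ≥ 2` SOME coordinate `j` has  `Σ_v w(v)·E₃(section at v) ≤ E₃(f)`  — i.e. subset chord superlinearity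
  (`SubsetChordSuperlinear`) holds with the CO-SINGLETON set `S = univ.erase j`.
* `subsetChordSuperlinear_of_coSingletonBound` : CoS → SCS (immediate), hence
  `sahiE_three_nonneg_of_coSingletonBound` : CoS → `E₃ ≥ 0` on every finite product cube (via the tree's `sahiE_three_nonneg_of_SCS`).
* `sahiE_three_oneCoin` (PROVED): the one-coin closed form `E₃(g) = p(1−p)·[(2−p)π₁π₂π₃ + Σ_a g_a(0)·π_bπ_c]` for three monotone
  `{0,1}`-valued functions of one bit with `P(bit = 1) = p`, `π_a = g_a(1) − g_a(0)`.
* `coSingletonSum_eq` (PROVED): the left side of CoS equals `q_j(1−q_j)·J_j` with the JOINT PIVOTALITY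
  `J_j = Σ_v w(v)·[(2−q_j)·π₁π₂π₃ + Σ_a f_a(lo)·π_bπ_c]`
  = `(2−q_j)·μ(j pivotal for all three) + Σ_a μ(j pivotal for f_b and f_c while f_a = 1)`; so CoS reads
  **`E₃(f) ≥ min_j q_j(1−q_j)·J_j`** (`coSingletonBound_iff`) — a Russo/Talagrand-type lower bound for Sahi's third functional by
  joint pivotality (compare `Cov(f,g) ≥ max_j q_j(1−q_j)·μ(j pivotal for f and g)`, which holds for EVERY `j`; for `E₃` the
  every-`j` form is false and the average form is false, see census below).

* `CoinRestAlternative` (BA, `@[conjecture]`, obligation of this programme): for EVERY coordinate `j`, the singleton `{j}` OR the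
  co-singleton `univ.erase j` satisfies the subset-chord inequality (`E₃ ≥ min(Z_{{j}}, Z_{univ∖{j}})`: per coordinate, the chord bound
  FBP(j) or the co-singleton bound CoS(j) holds).  Universal in `j`; `subsetChordSuperlinear_of_coinRestAlternative` : BA → SCS.
  Census (exact): `k = 2` symbolic (all 216 triples); `k = 3`: for ALL 1 540 triples and ALL `j` one of the two margins is a
  polynomial in `q` with nonnegative tensor-Bernstein coefficients (4 203 via the singleton, 417 via the co-singleton, 0 exceptions) — so BA
  holds on ≤ 3 coins for every weight vector; `k = 4` EXHAUSTIVE (804 440 triples) × 74 weight vectors incl. two-scale corners (ttrl cp-llc,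
  238 M (triple,q,j) cells): 0 violations, minimum `3.9·10⁻⁴·E₃` in the near-diagonal-OR corner; annealing `k ≤ 7`: 0 violations; every
  structured FBP-witness (doubled/tripled/augmented stars, windmill, cycles) has `J_j = 0` (co-singleton margin `= E₃`).  DEAD neighbours (exact witnesses, seat): the
  fixed-weight combination `q_j·margin(univ∖{j}) + (1−q_j)·margin({j}) ≥ 0` (false at `k = 3`; identically zero on a large family, so BA
  has no linear certificate of this shape) and the general bipartition alternative "for every split `(S, Sᶜ)` one side is good" (false at
  `k = 4`: `f₁ = x₀x₁`, `f₂ = f₃ = x₀x₁ ∨ x₂x₃`, `q = (1/10,1/10,9/10,9/10)`, splits `{0,2}|{1,3}`; and every transversal split of the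
  doubled star at `k = 6`).

Census for CoS (seat, exact/float, 2026-08-20; ttrl census requested, requests.jsonl l.583; ttrl k=4 exhaustive × 20 q: 0 violations): doubled-star witness of `not_chordSuperlinear_five`
(`k = 6`, `q = 2/3`): `J_j = 0` for all six `j` (all co-singletons good, margin `= E₃`); random `k = 4` (6 000) / `k = 5` (3 000)
triples × 11-value weight palette incl. `1/20, 19/20`: `min over instances of max_j [E₃ − q_j(1−q_j)J_j]/E₃ = +0.25 / +0.34`, no violation;
annealing `k = 4,5` found none.  Controls (known false): the every-`j` form (35 % of random `k = 4` instances have a bad co-singleton),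
the averaged form `Σ_j q_j(1−q_j)J_j ≤ k·E₃` (false: `f₁ = f₂ = (x₀x₁x₂) ∨ y`, `f₃ = x₀x₁x₂`, `p = 1/20`, `s = 19/20` gives `5.29·E₃ > 4·E₃`),
and the singleton form (per-coordinate FBP, refuted).  The infimum of the ratio is `0` (diagonal `OR_k` as `q → 1`:
margin `= u(ε² − u²) > 0`, `u = ε^k`), so CoS is a pure sign statement with no uniform constant.
-/

namespace Summit.CriticalPhenomena.PercolationContinuityZ3.Theorems

namespace SahiCoSingleton

open Finset Literature.Combinatorics.Sahi2008 SahiSubsetChord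

variable {ι : Type*} [Fintype ι] [DecidableEq ι]

/-- The configuration extending `v ∈ {0,1}^{univ.erase j}` by `x_j = false`. [this file] -/
def lo (j : ι) (v : {i // i ∈ (univ : Finset ι).erase j} → Bool) : ι → Bool :=
  glue ((univ : Finset ι).erase j) v (fun _ => false)

/-- The configuration extending `v ∈ {0,1}^{univ.erase j}` by `x_j = true`. [this file] -/
def hi (j : ι) (v : {i // i ∈ (univ : Finset ι).erase j} → Bool) : ι → Bool :=
  glue ((univ : Finset ι).erase j) v (fun _ => true)

/-- The CO-SINGLETON SECTION SUM `Z_{[k]−j} = Σ_v w_q(v) · E₃^{w_q|{j}}(x_j ↦ f(v, x_j))`: the expected `E₃` of the one-coin sections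
of `f` at coordinate `j` (the left side of `SubsetChordSuperlinear` at `S = univ.erase j`). [this file] -/
noncomputable def coSingletonSum (q : ι → ℝ) (f : Fin 3 → (ι → Bool) → ℝ) (j : ι) : ℝ :=
  ∑ v : ({i // i ∈ (univ : Finset ι).erase j} → Bool),
    prodWeight (fun i : {i // i ∈ (univ : Finset ι).erase j} => q i) v *
      sahiE (prodWeight fun i : {i // i ∉ (univ : Finset ι).erase j} => q i) 3
        (fun a y => f a (glue ((univ : Finset ι).erase j) v y))

/-- The JOINT PIVOTALITY of coordinate `j` for the triple `f`:
`J_j = Σ_v w_q(v)·[(2 − q_j)·π₁π₂π₃ + f₁(lo)π₂π₃ + f₂(lo)π₁π₃ + f₃(lo)π₁π₂]`, `π_a(v) = f_a(hi j v) − f_a(lo j v)`; for monotone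
indicator triples this is `(2−q_j)·μ(j pivotal for f₁,f₂,f₃) + Σ_a μ(j pivotal for f_b, f_c and f_a = 1)`, `μ` the product measure on
the other coordinates. [this file] -/
noncomputable def jointPivotality (q : ι → ℝ) (f : Fin 3 → (ι → Bool) → ℝ) (j : ι) : ℝ :=
  ∑ v : ({i // i ∈ (univ : Finset ι).erase j} → Bool),
    prodWeight (fun i : {i // i ∈ (univ : Finset ι).erase j} => q i) v *
      ((2 - q j) * ((f 0 (hi j v) - f 0 (lo j v)) * (f 1 (hi j v) - f 1 (lo j v)) * (f 2 (hi j v) - f 2 (lo j v)))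
        + (f 0 (lo j v) * ((f 1 (hi j v) - f 1 (lo j v)) * (f 2 (hi j v) - f 2 (lo j v)))
          + f 1 (lo j v) * ((f 0 (hi j v) - f 0 (lo j v)) * (f 2 (hi j v) - f 2 (lo j v)))
          + f 2 (lo j v) * ((f 0 (hi j v) - f 0 (lo j v)) * (f 1 (hi j v) - f 1 (lo j v)))))

/-- **CO-SINGLETON BOUND (CoS)** — a conjecture OF THIS PROGRAMME (seat prim-l12-p5, gen 2, 2026-08-20), the co-singleton
strengthening of `SubsetChordSuperlinear`: on every finite cube with at least two coordinates, every product weight and every triple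
of monotone indicator functions, SOME coordinate `j` satisfies `E[E₃ of the one-coin sections at j] ≤ E₃(f)`, equivalently
(`coSingletonBound_iff`) `q_j(1−q_j)·J_j ≤ E₃(f)`.  NOT asserted; census in the module docstring; implies `SubsetChordSuperlinear`
and hence Sahi's `C₃` for product measures (`sahiE_three_nonneg_of_coSingletonBound`). [this file] [status: open] -/
@[conjecture] def CoSingletonBound : Prop :=
  ∀ (ι : Type) [Fintype ι] [DecidableEq ι], 2 ≤ Fintype.card ι →
    ∀ (q : ι → ℝ), (∀ i, 0 ≤ q i ∧ q i ≤ 1) →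
      ∀ f : Fin 3 → (ι → Bool) → ℝ, (∀ a x, f a x = 0 ∨ f a x = 1) → (∀ a, Monotone (f a)) →
        ∃ j : ι,
          ∑ v : ({i // i ∈ (univ : Finset ι).erase j} → Bool),
              prodWeight (fun i : {i // i ∈ (univ : Finset ι).erase j} => q i) v *
                sahiE (prodWeight fun i : {i // i ∉ (univ : Finset ι).erase j} => q i) 3
                  (fun a y => f a (glue ((univ : Finset ι).erase j) v y))
            ≤ sahiE (prodWeight q) 3 f

/-- CoS implies subset chord superlinearity (take `S = univ.erase j`, which is nonempty and proper when `|ι| ≥ 2`). [this file] -/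
theorem subsetChordSuperlinear_of_coSingletonBound (H : CoSingletonBound) : SubsetChordSuperlinear := by
  intro ι _ _ hcard q hq f hind hmono
  obtain ⟨j, hj⟩ := H ι hcard q hq f hind hmono
  refine ⟨(univ : Finset ι).erase j, ?_, ?_, hj⟩
  · have h1 : 1 < Fintype.card ι := hcard
    obtain ⟨i, hi⟩ := Fintype.exists_ne_of_one_lt_card h1 j
    exact ⟨i, Finset.mem_erase.mpr ⟨hi, Finset.mem_univ i⟩⟩
  · intro h
    have : j ∈ (univ : Finset ι).erase j := by rw [h]; exact Finset.mem_univ j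
    exact (Finset.mem_erase.mp this).1 rfl

/-- CoS implies `E₃ ≥ 0` for every triple of monotone indicator functions on every finite product cube (Sahi's `C₃` / Kahn's
Conjecture 5, product-measure case), via `SubsetChordSuperlinear`. [this file] -/
theorem sahiE_three_nonneg_of_coSingletonBound (H : CoSingletonBound) {ι : Type} [Fintype ι] [DecidableEq ι] (q : ι → ℝ)
    (hq : ∀ i, 0 ≤ q i ∧ q i ≤ 1) (f : Fin 3 → (ι → Bool) → ℝ) (hind : ∀ a x, f a x = 0 ∨ f a x = 1)
    (hmono : ∀ a, Monotone (f a)) : 0 ≤ sahiE (prodWeight q) 3 f :=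
  sahiE_three_nonneg_of_SCS (subsetChordSuperlinear_of_coSingletonBound H) q hq f hind hmono

/-- **One-coin closed form.**  For three monotone `{0,1}`-valued functions `g_a` of a single bit with `P(bit = 1) = p`:
`E₃(g) = p(1−p)·[(2−p)·π₁π₂π₃ + g₁(0)π₂π₃ + g₂(0)π₁π₃ + g₃(0)π₁π₂]`, `π_a = g_a(1) − g_a(0)`
(so `E₃ ∈ {0, p(1−p), p(1−p)(2−p)}`). [this file] -/
theorem sahiE_three_oneCoin {κ : Type*} [Fintype κ] [DecidableEq κ] (i₀ : κ) (huniq : ∀ i : κ, i = i₀) (q : κ → ℝ)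
    (g : Fin 3 → (κ → Bool) → ℝ) (hind : ∀ a x, g a x = 0 ∨ g a x = 1) (hmono : ∀ a, Monotone (g a)) :
    sahiE (prodWeight q) 3 g =
      q i₀ * (1 - q i₀) *
        ((2 - q i₀) * ((g 0 (fun _ => true) - g 0 (fun _ => false)) * (g 1 (fun _ => true) - g 1 (fun _ => false))
            * (g 2 (fun _ => true) - g 2 (fun _ => false)))
          + (g 0 (fun _ => false) * ((g 1 (fun _ => true) - g 1 (fun _ => false)) * (g 2 (fun _ => true) - g 2 (fun _ => false)))
            + g 1 (fun _ => false) * ((g 0 (fun _ => true) - g 0 (fun _ => false)) * (g 2 (fun _ => true) - g 2 (fun _ => false)))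
            + g 2 (fun _ => false) * ((g 0 (fun _ => true) - g 0 (fun _ => false)) * (g 1 (fun _ => true) - g 1 (fun _ => false))))) := by
  letI : Unique κ := ⟨⟨i₀⟩, huniq⟩
  have hsum : ∀ G : (κ → Bool) → ℝ, ∑ x, G x = G (fun _ => false) + G (fun _ => true) := by
    intro G
    rw [← (Equiv.funUnique κ Bool).symm.sum_comp, Fintype.sum_bool, add_comm]
    rfl
  have hw : ∀ b : Bool, prodWeight q (fun _ : κ => b) = if b then q i₀ else 1 - q i₀ := by
    intro b; simp only [prodWeight, Fintype.prod_unique]; rfl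
  have hcases : ∀ a, (g a (fun _ => false) = 0 ∧ g a (fun _ => true) = 0) ∨
      (g a (fun _ => false) = 0 ∧ g a (fun _ => true) = 1) ∨ (g a (fun _ => false) = 1 ∧ g a (fun _ => true) = 1) := by
    intro a
    have hle : g a (fun _ => false) ≤ g a (fun _ => true) := hmono a (fun _ => Bool.false_le _)
    rcases hind a (fun _ => false) with h0 | h0 <;> rcases hind a (fun _ => true) with h1 | h1
    · exact Or.inl ⟨h0, h1⟩
    · exact Or.inr (Or.inl ⟨h0, h1⟩)
    · exfalso; rw [h0, h1] at hle; linarith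
    · exact Or.inr (Or.inr ⟨h0, h1⟩)
  rw [sahiE_three_apply]
  simp only [ex, hsum, hw, Pi.mul_apply, if_true, Bool.false_eq_true, if_false]
  rcases hcases 0 with ⟨a0, a1⟩ | ⟨a0, a1⟩ | ⟨a0, a1⟩ <;>
    rcases hcases 1 with ⟨b0, b1⟩ | ⟨b0, b1⟩ | ⟨b0, b1⟩ <;>
    rcases hcases 2 with ⟨c0, c1⟩ | ⟨c0, c1⟩ | ⟨c0, c1⟩ <;>
    simp only [a0, a1, b0, b1, c0, c1] <;> ring

/-- **The co-singleton identity**: the expected `E₃` of the one-coin sections at `j` equals `q_j(1−q_j)` times the joint pivotality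
`J_j` (monotone indicator triple). [this file] -/
theorem coSingletonSum_eq (q : ι → ℝ) (f : Fin 3 → (ι → Bool) → ℝ) (hind : ∀ a x, f a x = 0 ∨ f a x = 1)
    (hmono : ∀ a, Monotone (f a)) (j : ι) :
    coSingletonSum q f j = q j * (1 - q j) * jointPivotality q f j := by
  unfold coSingletonSum jointPivotality
  rw [Finset.mul_sum]
  refine Finset.sum_congr rfl fun v _ => ?_
  have hj : j ∉ (univ : Finset ι).erase j := fun h => (Finset.mem_erase.mp h).1 rfl
  have huniq : ∀ i : {i // i ∉ (univ : Finset ι).erase j}, i = ⟨j, hj⟩ := by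
    rintro ⟨i, hi⟩
    refine Subtype.ext ?_
    by_contra hne
    exact hi (Finset.mem_erase.mpr ⟨hne, Finset.mem_univ i⟩)
  rw [sahiE_three_oneCoin ⟨j, hj⟩ huniq (fun i : {i // i ∉ (univ : Finset ι).erase j} => q i)
      (fun a y => f a (glue ((univ : Finset ι).erase j) v y)) (fun a y => hind a _)
      (fun a => (hmono a).comp (glue_mono _ v))]
  simp only [lo, hi]
  ring

/-- CoS in PIVOTAL FORM: `CoSingletonBound ↔` on every finite product cube (`|ι| ≥ 2`) and every monotone indicator triple some
coordinate has `q_j(1−q_j)·J_j ≤ E₃(f)`. [this file] -/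
theorem coSingletonBound_iff :
    CoSingletonBound ↔
      ∀ (ι : Type) [Fintype ι] [DecidableEq ι], 2 ≤ Fintype.card ι →
        ∀ (q : ι → ℝ), (∀ i, 0 ≤ q i ∧ q i ≤ 1) →
          ∀ f : Fin 3 → (ι → Bool) → ℝ, (∀ a x, f a x = 0 ∨ f a x = 1) → (∀ a, Monotone (f a)) →
            ∃ j : ι, q j * (1 - q j) * jointPivotality q f j ≤ sahiE (prodWeight q) 3 f := by
  constructor
  · intro H ι _ _ hcard q hq f hind hmono
    obtain ⟨j, hj⟩ := H ι hcard q hq f hind hmono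
    refine ⟨j, ?_⟩
    have := coSingletonSum_eq q f hind hmono j
    unfold coSingletonSum at this
    rw [← this]; exact hj
  · intro H ι _ _ hcard q hq f hind hmono
    obtain ⟨j, hj⟩ := H ι hcard q hq f hind hmono
    refine ⟨j, ?_⟩
    have := coSingletonSum_eq q f hind hmono j
    unfold coSingletonSum at this
    rw [this]; exact hj

/-- **COIN-vs-REST ALTERNATIVE (BA)** — a conjecture OF THIS PROGRAMME (seat prim-l12-p5, gen 2, 2026-08-20): on every finite cube with at
least two coordinates, every product weight and every triple of monotone indicator functions, for EVERY coordinate `j` either the singleton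
`S = {j}` (chord bound FBP(j): `(1−q_j)E₃(f|x_j=0) + q_jE₃(f|x_j=1) ≤ E₃(f)`) or the co-singleton `S = univ.erase j` (`q_j(1−q_j)J_j ≤ E₃(f)`)
satisfies the subset-chord inequality.  NOT asserted; census and dead neighbours in the module docstring; implies `SubsetChordSuperlinear`
(`subsetChordSuperlinear_of_coinRestAlternative`) and hence Sahi's `C₃` on product cubes. [this file] [status: open] -/
@[conjecture] def CoinRestAlternative : Prop :=
  ∀ (ι : Type) [Fintype ι] [DecidableEq ι], 2 ≤ Fintype.card ι →
    ∀ (q : ι → ℝ), (∀ i, 0 ≤ q i ∧ q i ≤ 1) →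
      ∀ f : Fin 3 → (ι → Bool) → ℝ, (∀ a x, f a x = 0 ∨ f a x = 1) → (∀ a, Monotone (f a)) →
        ∀ j : ι,
          (∑ v : ({i // i ∈ ({j} : Finset ι)} → Bool),
              prodWeight (fun i : {i // i ∈ ({j} : Finset ι)} => q i) v *
                sahiE (prodWeight fun i : {i // i ∉ ({j} : Finset ι)} => q i) 3
                  (fun a y => f a (glue ({j} : Finset ι) v y))
            ≤ sahiE (prodWeight q) 3 f) ∨
          (∑ v : ({i // i ∈ (univ : Finset ι).erase j} → Bool),
              prodWeight (fun i : {i // i ∈ (univ : Finset ι).erase j} => q i) v *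
                sahiE (prodWeight fun i : {i // i ∉ (univ : Finset ι).erase j} => q i) 3
                  (fun a y => f a (glue ((univ : Finset ι).erase j) v y))
            ≤ sahiE (prodWeight q) 3 f)

/-- BA implies subset chord superlinearity: pick any coordinate `j`; one of `{j}`, `univ.erase j` is a good nonempty proper `S`. [this file] -/
theorem subsetChordSuperlinear_of_coinRestAlternative (H : CoinRestAlternative) : SubsetChordSuperlinear := by
  intro ι _ _ hcard q hq f hind hmono
  have h1 : 1 < Fintype.card ι := hcard
  have h0 : 0 < Fintype.card ι := lt_trans Nat.zero_lt_one h1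
  obtain ⟨j⟩ := Fintype.card_pos_iff.mp h0
  obtain ⟨i, hi⟩ := Fintype.exists_ne_of_one_lt_card h1 j
  rcases H ι hcard q hq f hind hmono j with hS | hS
  · refine ⟨({j} : Finset ι), ⟨j, Finset.mem_singleton_self j⟩, ?_, hS⟩
    intro h
    have : i ∈ ({j} : Finset ι) := by rw [h]; exact Finset.mem_univ i
    exact hi (Finset.mem_singleton.mp this)
  · refine ⟨(univ : Finset ι).erase j, ⟨i, Finset.mem_erase.mpr ⟨hi, Finset.mem_univ i⟩⟩, ?_, hS⟩
    intro h
    have : j ∈ (univ : Finset ι).erase j := by rw [h]; exact Finset.mem_univ j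
    exact (Finset.mem_erase.mp this).1 rfl

/-- BA implies `E₃ ≥ 0` for every triple of monotone indicator functions on every finite product cube. [this file] -/
theorem sahiE_three_nonneg_of_coinRestAlternative (H : CoinRestAlternative) {ι : Type} [Fintype ι] [DecidableEq ι] (q : ι → ℝ)
    (hq : ∀ i, 0 ≤ q i ∧ q i ≤ 1) (f : Fin 3 → (ι → Bool) → ℝ) (hind : ∀ a x, f a x = 0 ∨ f a x = 1)
    (hmono : ∀ a, Monotone (f a)) : 0 ≤ sahiE (prodWeight q) 3 f :=
  sahiE_three_nonneg_of_SCS (subsetChordSuperlinear_of_coinRestAlternative H) q hq f hind hmono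

/-- CoS implies BA (the co-singleton disjunct). [this file] -/
theorem coinRestAlternative_of_coSingletonBound_pointwise {ι : Type} [Fintype ι] [DecidableEq ι] (q : ι → ℝ)
    (f : Fin 3 → (ι → Bool) → ℝ) (j : ι)
    (h : coSingletonSum q f j ≤ sahiE (prodWeight q) 3 f) :
    (∑ v : ({i // i ∈ ({j} : Finset ι)} → Bool),
        prodWeight (fun i : {i // i ∈ ({j} : Finset ι)} => q i) v *
          sahiE (prodWeight fun i : {i // i ∉ ({j} : Finset ι)} => q i) 3 (fun a y => f a (glue ({j} : Finset ι) v y))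
      ≤ sahiE (prodWeight q) 3 f) ∨
    (coSingletonSum q f j ≤ sahiE (prodWeight q) 3 f) := Or.inr h

/-! ### Appendix (gen 2, later the same day): the HALF-co-singleton bound — a universal, quantitative form

`HalfCoSingletonBound` (HC): for EVERY coordinate `j`, `E[E₃ of the one-coin sections at j] ≤ 2·E₃(f)`, i.e. `E₃(f) ≥ ½·q_j(1−q_j)·J_j`
for all `j` — conditioning on all but one coordinate at most DOUBLES the expected `E₃`.  Universal in `j` (no existential), hence a single
cubic inequality per coordinate; since `J_j ≥ 0` termwise (`jointPivotality_nonneg`) it contains Sahi's `C₃` outright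
(`sahiE_three_nonneg_of_halfCoSingletonBound`) and is the `E₃`-analogue of the Talagrand-type bound `Cov(f,g) ≥ max_j q_j(1−q_j)μ(j pivotal
for both)` (constant `1` for `E₂`, conjecturally `½` for `E₃`).  The constant `2` is SHARP: on `f₁ = f₂ = (x₀⋯x_{m−1}) ∨ y`, `f₃ = x₀⋯x_{m−1}`
with `P(x_i) = p → 0`, `P(y) = s → 1` the ratio `Z_{[k]−i}/E₃ = (1−p)(2−p)/[(1−π)(2−π−s+πs)] → 2/(2−s) → 2`.  Census (seat, exact): `k = 3`: for ALL
1 540 triples and ALL `j`, `2E₃ − Z_{[k]−j}` has nonnegative tensor-Bernstein coefficients (3 831 certified, 789 identically zero, 0 exceptions) —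
HC holds on ≤ 3 coins for every weight vector; annealing `k = 3..7` with weights down to `1/200`: sup of the ratio found `1.995 < 2`.  NOT asserted.
-/

/-- The joint pivotality is nonnegative for a monotone indicator triple (each summand is a product of `f_a(lo) ∈ {0,1}` and section
increments `f_b(hi) − f_b(lo) ∈ {0,1}`, with `2 − q_j ≥ 0`). [this file] -/
theorem jointPivotality_nonneg (q : ι → ℝ) (hq : ∀ i, 0 ≤ q i ∧ q i ≤ 1) (f : Fin 3 → (ι → Bool) → ℝ)
    (hind : ∀ a x, f a x = 0 ∨ f a x = 1) (hmono : ∀ a, Monotone (f a)) (j : ι) : 0 ≤ jointPivotality q f j := by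
  unfold jointPivotality
  refine Finset.sum_nonneg fun v _ => mul_nonneg
    (prodWeight_nonneg (q := fun i : {i // i ∈ (univ : Finset ι).erase j} => q i) (fun i => hq i) v) ?_
  have hlohi : lo j v ≤ hi j v := by
    intro i
    unfold lo hi glue
    split_ifs
    · exact le_rfl
    · exact Bool.false_le _
  have hπ : ∀ a, 0 ≤ f a (hi j v) - f a (lo j v) := fun a => sub_nonneg.mpr (hmono a hlohi)
  have hlo : ∀ a, 0 ≤ f a (lo j v) := fun a => by rcases hind a (lo j v) with h | h <;> simp [h]
  have h2q : 0 ≤ 2 - q j := by linarith [(hq j).2]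
  have := hπ 0; have := hπ 1; have := hπ 2; have := hlo 0; have := hlo 1; have := hlo 2
  positivity

/-- The co-singleton section sum is nonnegative (`= q_j(1−q_j)·J_j` with `J_j ≥ 0`). [this file] -/
theorem coSingletonSum_nonneg (q : ι → ℝ) (hq : ∀ i, 0 ≤ q i ∧ q i ≤ 1) (f : Fin 3 → (ι → Bool) → ℝ)
    (hind : ∀ a x, f a x = 0 ∨ f a x = 1) (hmono : ∀ a, Monotone (f a)) (j : ι) : 0 ≤ coSingletonSum q f j := by
  rw [coSingletonSum_eq q f hind hmono j]
  exact mul_nonneg (mul_nonneg (hq j).1 (by linarith [(hq j).2])) (jointPivotality_nonneg q hq f hind hmono j)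

/-- **HALF-CO-SINGLETON BOUND (HC)** — a conjecture OF THIS PROGRAMME (seat prim-l12-p5, gen 2, 2026-08-20): on every finite cube with at least two
coordinates, every product weight and every monotone indicator triple, for EVERY coordinate `j`:
`E[E₃ of the one-coin sections at j] ≤ 2·E₃(f)` (equivalently `E₃(f) ≥ ½·q_j(1−q_j)·J_j` for all `j`; the constant `2` is sharp).
NOT asserted; census in the appendix docstring above; contains Sahi's `C₃` on product cubes (`sahiE_three_nonneg_of_halfCoSingletonBound`).
[this file] [status: open] -/
@[conjecture] def HalfCoSingletonBound : Prop :=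
  ∀ (ι : Type) [Fintype ι] [DecidableEq ι], 2 ≤ Fintype.card ι →
    ∀ (q : ι → ℝ), (∀ i, 0 ≤ q i ∧ q i ≤ 1) →
      ∀ f : Fin 3 → (ι → Bool) → ℝ, (∀ a x, f a x = 0 ∨ f a x = 1) → (∀ a, Monotone (f a)) →
        ∀ j : ι, coSingletonSum q f j ≤ 2 * sahiE (prodWeight q) 3 f

/-- HC contains Sahi's `C₃` on product cubes with at least two coordinates: `0 ≤ Z_{[k]−j} ≤ 2E₃`. [this file] -/
theorem sahiE_three_nonneg_of_halfCoSingletonBound (H : HalfCoSingletonBound) {ι : Type} [Fintype ι] [DecidableEq ι]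
    (hcard : 2 ≤ Fintype.card ι) (q : ι → ℝ) (hq : ∀ i, 0 ≤ q i ∧ q i ≤ 1) (f : Fin 3 → (ι → Bool) → ℝ)
    (hind : ∀ a x, f a x = 0 ∨ f a x = 1) (hmono : ∀ a, Monotone (f a)) : 0 ≤ sahiE (prodWeight q) 3 f := by
  have h1 : 1 < Fintype.card ι := hcard
  obtain ⟨j⟩ := Fintype.card_pos_iff.mp (lt_trans Nat.zero_lt_one h1)
  have hZ := coSingletonSum_nonneg q hq f hind hmono j
  have hH := H ι hcard q hq f hind hmono j
  linarith

/-- HC implies the co-singleton disjunct's quantitative half: `E₃ ≥ ½ Z_{[k]−j}` for every `j` (restatement). [this file] -/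
theorem half_coSingletonSum_le_of_halfCoSingletonBound (H : HalfCoSingletonBound) {ι : Type} [Fintype ι] [DecidableEq ι]
    (hcard : 2 ≤ Fintype.card ι) (q : ι → ℝ) (hq : ∀ i, 0 ≤ q i ∧ q i ≤ 1) (f : Fin 3 → (ι → Bool) → ℝ)
    (hind : ∀ a x, f a x = 0 ∨ f a x = 1) (hmono : ∀ a, Monotone (f a)) (j : ι) :
    (1 / 2 : ℝ) * (q j * (1 - q j) * jointPivotality q f j) ≤ sahiE (prodWeight q) 3 f := by
  have hH := H ι hcard q hq f hind hmono j
  rw [coSingletonSum_eq q f hind hmono j] at hH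
  linarith

end SahiCoSingleton

end Summit.CriticalPhenomena.PercolationContinuityZ3.Theorems
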